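import Mathlib
import HarnessLib
import Summits.AtomisticToContinuum.FouriersLaw.Theses.JunctionLocality
import Summits.AtomisticToContinuum.FouriersLaw.Theorems.JunctionLocalitySuperadditiveResistanceDeviceLiouville
import Summits.AtomisticToContinuum.FouriersLaw.Theorems.JunctionLocalitySuperadditiveResistanceStubTerminationLocalityAux1
import Summits.AtomisticToContinuum.FouriersLaw.Theorems.JunctionLocalitySuperadditiveResistanceStubTerminationLocalityAux2

/-!
# Termination locality in Kubo form, helper III: reduction of the stub to ONE block, division-free
(stub `stub_terminationLocality` of line `floating-probe-bypass-laplacian`, crux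
`JunctionLocality.SuperadditiveResistance`, stmt-AtomisticToContinuum-11748)

The registered stub asks, `N`-uniformly, for `1/G_N − 1/K_00 ≤ C₁` (left block) and
`1/G_M − 1/K_33 ≤ C₁` (right block, the bare `M`-chain entering through its LEFT forward field).
With the block swap of helper II this file shows that the right-block clause IS the left-block
clause of the swapped split `(M, N)`:

* `comp_blockSwap_mem_deviceForwardFields`, `swapFamily_mem`: terminal forward fields of the
  `(N, M)`-device pull back along `Φ_{M,N}` to terminal forward fields of the `(M, N)`-device with
  reversed terminal labels (`C²`, `L²(μ_T)`, mean zero and the Poisson equation all transport);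
* `kuboMatrix_swapFamily`: `K^{(M,N)}[g'](a, b) = K^{(N,M)}[g](rev a, rev b)`, in particular
  `K^{(M,N)}_{00}[g'] = K^{(N,M)}_{33}[g]`;
* `twoBlock_of_oneBlock`: an `N`-uniform, division-free ONE-block estimate
  `K_00 − G_N ≤ C·G_N·K_00` for all splits gives both blocks;
* `terminationLocality_of_oneBlock` (registered as `helper_terminationReduction`): … and, given
  positivity of `G_N, G_M, K_00, K_33` (fixed-`N` facts supplied in the line's composition by the
  Kubo link with `D > 0` and by the Onsager-Laplacian structure of the Kubo matrix), the registered
  two-block resistance form with the same constant (`one_div_sub_one_div_le_of_defect`, helper I).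

What is NOT here is the one-block estimate itself — the `N`-uniform content of termination
locality (renewal at the γ-thermostatted site `N−1`; nothing of the kind is in the tree or in
print). Everything in this file is fixed-`N` kinematics and real algebra.
-/

noncomputable section

open MeasureTheory Filter Topology
open scoped ContDiff
open Literature.MathematicalPhysics.KineticTheory.HeatConduction
open Summit.AtomisticToContinuum.FouriersLaw.Theorems.SuperadditiveResistance.DeviceLiouville

namespace Summit.AtomisticToContinuum.FouriersLaw.Theorems.SuperadditiveResistance.TerminationLocality

/-! ## The block swap at the level of the line's vocabulary -/

section SwapVocabulary

variable {ω₂ lam β γ T : ℝ} {N M : ℕ}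

/-- Terminal sites are sites: `termSite N M a < N + M` (`N, M ≥ 1`). -/
theorem termSite_lt (hN : 1 ≤ N) (hM : 1 ≤ M) (a : Fin 4) : termSite N M a < N + M := by
  fin_cases a <;> simp [termSite] <;> omega

/-- The block swap reverses the terminal labels: site `termSite N M (rev c)` of the split `(N, M)`
is site `termSite M N c` of the split `(M, N)` (`N, M ≥ 1`). -/
theorem termSite_rev_add (hN : 1 ≤ N) (hM : 1 ≤ M) (c : Fin 4) :
    termSite N M (Fin.rev c) + termSite M N c = N + M - 1 := by
  fin_cases c <;> simp [termSite, Fin.rev] <;> omega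

/-- **Forward fields transport under the block swap.** A forward field of the `(N, M)`-device for
the kinetic observable of site `s` pulls back along `Φ_{M,N}` to a forward field of the
`(M, N)`-device for site `s' = N+M−1−s`. -/
theorem comp_blockSwap_mem_deviceForwardFields (hN : 1 ≤ N) (hM : 1 ≤ M) {s s' : ℕ}
    (hs : s + s' = N + M - 1) (hs' : s' < M + N) {g : PhaseSpace (N + M) → ℝ}
    (hg : g ∈ deviceForwardFields ω₂ lam β γ T N M s) :
    g ∘ blockSwap M N ∈ deviceForwardFields ω₂ lam β γ T M N s' := by
  have hV : ∀ r, (pinnedChain ω₂ lam β γ).V (-r) = (pinnedChain ω₂ lam β γ).V r := fun r => by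
    show (-r) ^ 2 / 2 + β * (-r) ^ 4 / 4 = r ^ 2 / 2 + β * r ^ 4 / 4; ring
  obtain ⟨hC, hL2, hmean, hpde⟩ := hg
  refine ⟨hC.comp (blockSwap M N).contDiff, memLp_comp_blockSwap _ hV T hL2, ?_, fun y => ?_⟩
  · rw [← hmean]
    exact integral_gibbsMeasure_comp_blockSwap _ hV T g
  · rw [deviceGenerator_comp_blockSwap_const _ hV hM hN T g y, hpde,
      kin_blockSwap (N := M) (M := N) (s := s') (s' := s) (by omega) hs' y]

variable (N M) in
/-- The SWAPPED FAMILY of terminal fields: terminal `c` of the `(M, N)`-device is terminal `rev c`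
of the `(N, M)`-device, read through `Φ_{M,N}`. -/
def swapFamily (g : Fin 4 → PhaseSpace (N + M) → ℝ) : Fin 4 → PhaseSpace (M + N) → ℝ :=
  fun c => g (Fin.rev c) ∘ blockSwap M N

/-- The swapped family of a family of terminal forward fields is a family of terminal forward
fields of the swapped device (`N, M ≥ 1`). -/
theorem swapFamily_mem (hN : 1 ≤ N) (hM : 1 ≤ M) {g : Fin 4 → PhaseSpace (N + M) → ℝ}
    (hg : ∀ a : Fin 4, g a ∈ deviceForwardFields ω₂ lam β γ T N M (termSite N M a)) (c : Fin 4) :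
    swapFamily N M g c ∈ deviceForwardFields ω₂ lam β γ T M N (termSite M N c) :=
  comp_blockSwap_mem_deviceForwardFields hN hM (termSite_rev_add hN hM c)
    (termSite_lt hM hN c) (hg (Fin.rev c))

/-- **The Kubo matrix of the swapped family is the Kubo matrix with reversed terminal labels**:
`K^{(M,N)}[g'] (a, b) = K^{(N,M)}[g] (rev a, rev b)` (`N, M ≥ 1`; any family `g`). -/
theorem kuboMatrix_swapFamily (ω₂ lam β γ T : ℝ) (hN : 1 ≤ N) (hM : 1 ≤ M)
    (g : Fin 4 → PhaseSpace (N + M) → ℝ) (a b : Fin 4) :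
    kuboMatrix ω₂ lam β γ T M N (swapFamily N M g) a b =
      kuboMatrix ω₂ lam β γ T N M g (Fin.rev a) (Fin.rev b) := by
  have hV : ∀ r, (pinnedChain ω₂ lam β γ).V (-r) = (pinnedChain ω₂ lam β γ).V r := fun r => by
    show (-r) ^ 2 / 2 + β * (-r) ^ 4 / 4 = r ^ 2 / 2 + β * r ^ 4 / 4; ring
  have hint : ∫ y, swapFamily N M g a y * (kin (M + N) (termSite M N b) y - T)
        ∂((pinnedChain ω₂ lam β γ).gibbsMeasure (M + N) T) =
      ∫ x, g (Fin.rev a) x * (kin (N + M) (termSite N M (Fin.rev b)) x - T)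
        ∂((pinnedChain ω₂ lam β γ).gibbsMeasure (N + M) T) := by
    rw [← integral_gibbsMeasure_comp_blockSwap (N := M) (M := N) _ hV T]
    refine integral_congr_ae (Filter.Eventually.of_forall fun y => ?_)
    simp only [swapFamily, Function.comp_apply]
    rw [kin_blockSwap (N := M) (M := N) (s := termSite M N b) (s' := termSite N M (Fin.rev b))
      (by have := termSite_rev_add hN hM b; omega) (termSite_lt hM hN b) y]
  simp only [kuboMatrix, hint, Fin.rev_inj]

/-- In particular `K^{(M,N)}_{00}[g'] = K^{(N,M)}_{33}[g]`: the self-conductance of the RIGHT bath of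
the `(N, M)`-device is the self-conductance of the LEFT bath of the swapped device. -/
theorem kuboMatrix_swapFamily_zero_zero (ω₂ lam β γ T : ℝ) (hN : 1 ≤ N) (hM : 1 ≤ M)
    (g : Fin 4 → PhaseSpace (N + M) → ℝ) :
    kuboMatrix ω₂ lam β γ T M N (swapFamily N M g) 0 0 = kuboMatrix ω₂ lam β γ T N M g 3 3 :=
  kuboMatrix_swapFamily ω₂ lam β γ T hN hM g 0 0

end SwapVocabulary


/-! ## Positivity of the diagonal of an Onsager Laplacian (for the reshaped composition) -/

section Onsager

/-- The set of four-terminal ONSAGER LAPLACIANS: symmetric, zero row sums, positive semidefinite, kernel =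
constants (a cone of matrices — an object, not a proposition). -/
def onsagerLaplacians₄ : Set (Matrix (Fin 4) (Fin 4) ℝ) :=
  {K | K.IsSymm ∧ (∀ a, ∑ b, K a b = 0) ∧ (∀ θ : Fin 4 → ℝ, 0 ≤ ∑ a, ∑ b, θ a * K a b * θ b) ∧
    (∀ θ : Fin 4 → ℝ, ∑ a, ∑ b, θ a * K a b * θ b = 0 → ∀ a b, θ a = θ b)}

/-- The diagonal entries of a four-terminal Onsager Laplacian are positive (test the quadratic form
on the indicator of one terminal; a vanishing value would put a non-constant vector in the kernel).
With `stub_kuboOnsager` this supplies `0 < K_00`, `0 < K_33` to `terminationLocality_of_oneBlock`. -/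
theorem diag_pos_of_mem_onsagerLaplacians₄ {K : Matrix (Fin 4) (Fin 4) ℝ}
    (h : K ∈ onsagerLaplacians₄) (a : Fin 4) : 0 < K a a := by
  obtain ⟨-, -, hpsd, hker⟩ := h
  set θ : Fin 4 → ℝ := fun b => if b = a then 1 else 0 with hθ
  have hq : ∑ b, ∑ c, θ b * K b c * θ c = K a a := by
    simp only [hθ]
    rw [Finset.sum_eq_single a]
    · rw [Finset.sum_eq_single a]
      · simp
      · intro c _ hc; simp [hc]
      · intro h; exact absurd (Finset.mem_univ _) h
    · intro b _ hb; simp [hb]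
    · intro h; exact absurd (Finset.mem_univ _) h
  have h0 : 0 ≤ K a a := hq ▸ hpsd θ
  rcases h0.lt_or_eq with hlt | heq
  · exact hlt
  · exfalso
    have hz : ∑ b, ∑ c, θ b * K b c * θ c = 0 := by rw [hq, ← heq]
    obtain ⟨b, hb⟩ : ∃ b : Fin 4, b ≠ a := ⟨a + 1, by fin_cases a <;> decide⟩
    have := hker θ hz a b
    simp [hθ, hb] at this

end Onsager

/-! ## Reduction of the stub to ONE block, division-free -/

section Reduction

variable (ω₂ lam β γ T : ℝ)

/-- **Two blocks from one.** A division-free, `N`-uniform LEFT-block termination-locality estimate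
for all splits, `K_00 − G_N ≤ C·G_N·K_00`, gives the right-block estimate `K_33 − G_M ≤ C·G_M·K_33`
as well (apply it to the swapped split `(M, N)` and the swapped family). -/
theorem twoBlock_of_oneBlock {C : ℝ}
    (h : ∀ N M : ℕ, 2 ≤ N → 2 ≤ M →
      ∀ (g : Fin 4 → PhaseSpace (N + M) → ℝ) (gN : PhaseSpace N → ℝ),
        (∀ a : Fin 4, g a ∈ deviceForwardFields ω₂ lam β γ T N M (termSite N M a)) →
        gN ∈ plainForwardFields ω₂ lam β γ T N →
        kuboMatrix ω₂ lam β γ T N M g 0 0 - plainKubo ω₂ lam β γ T N gN ≤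
          C * plainKubo ω₂ lam β γ T N gN * kuboMatrix ω₂ lam β γ T N M g 0 0)
    (N M : ℕ) (hN : 2 ≤ N) (hM : 2 ≤ M) (g : Fin 4 → PhaseSpace (N + M) → ℝ)
    (gN : PhaseSpace N → ℝ) (gM : PhaseSpace M → ℝ)
    (hg : ∀ a : Fin 4, g a ∈ deviceForwardFields ω₂ lam β γ T N M (termSite N M a))
    (hgN : gN ∈ plainForwardFields ω₂ lam β γ T N) (hgM : gM ∈ plainForwardFields ω₂ lam β γ T M) :
    kuboMatrix ω₂ lam β γ T N M g 0 0 - plainKubo ω₂ lam β γ T N gN ≤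
        C * plainKubo ω₂ lam β γ T N gN * kuboMatrix ω₂ lam β γ T N M g 0 0 ∧
      kuboMatrix ω₂ lam β γ T N M g 3 3 - plainKubo ω₂ lam β γ T M gM ≤
        C * plainKubo ω₂ lam β γ T M gM * kuboMatrix ω₂ lam β γ T N M g 3 3 := by
  refine ⟨h N M hN hM g gN hg hgN, ?_⟩
  have h' := h M N hM hN (swapFamily N M g) gM (swapFamily_mem (by omega) (by omega) hg) hgM
  rwa [kuboMatrix_swapFamily_zero_zero ω₂ lam β γ T (by omega) (by omega)] at h'

/-- **What the registered stub `stub_terminationLocality` reduces to.** Its two-block resistance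
form follows from (i) the `N`-uniform, division-free, ONE-block estimate
`K_00 − G_N ≤ C·G_N·K_00` for all splits (the genuine content of termination locality — NOT proved
here) and (ii) positivity of the four conductances involved (fixed-`N` facts supplied in the line's
composition by the neighbouring stubs: `G > 0` by the Kubo link and `D > 0`, `K_00, K_33 > 0` by the
Onsager-Laplacian structure of the Kubo matrix). -/
theorem terminationLocality_of_oneBlock {C : ℝ}
    (h : ∀ N M : ℕ, 2 ≤ N → 2 ≤ M →
      ∀ (g : Fin 4 → PhaseSpace (N + M) → ℝ) (gN : PhaseSpace N → ℝ),
        (∀ a : Fin 4, g a ∈ deviceForwardFields ω₂ lam β γ T N M (termSite N M a)) →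
        gN ∈ plainForwardFields ω₂ lam β γ T N →
        kuboMatrix ω₂ lam β γ T N M g 0 0 - plainKubo ω₂ lam β γ T N gN ≤
          C * plainKubo ω₂ lam β γ T N gN * kuboMatrix ω₂ lam β γ T N M g 0 0)
    (N M : ℕ) (hN : 2 ≤ N) (hM : 2 ≤ M) (g : Fin 4 → PhaseSpace (N + M) → ℝ)
    (gN : PhaseSpace N → ℝ) (gM : PhaseSpace M → ℝ)
    (hg : ∀ a : Fin 4, g a ∈ deviceForwardFields ω₂ lam β γ T N M (termSite N M a))
    (hgN : gN ∈ plainForwardFields ω₂ lam β γ T N) (hgM : gM ∈ plainForwardFields ω₂ lam β γ T M)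
    (hGN : 0 < plainKubo ω₂ lam β γ T N gN) (hGM : 0 < plainKubo ω₂ lam β γ T M gM)
    (hK0 : 0 < kuboMatrix ω₂ lam β γ T N M g 0 0) (hK3 : 0 < kuboMatrix ω₂ lam β γ T N M g 3 3) :
    1 / plainKubo ω₂ lam β γ T N gN - 1 / kuboMatrix ω₂ lam β γ T N M g 0 0 ≤ C ∧
      1 / plainKubo ω₂ lam β γ T M gM - 1 / kuboMatrix ω₂ lam β γ T N M g 3 3 ≤ C := by
  obtain ⟨h0, h3⟩ := twoBlock_of_oneBlock ω₂ lam β γ T h N M hN hM g gN gM hg hgN hgM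
  exact ⟨one_div_sub_one_div_le_of_defect hGN hK0 h0, one_div_sub_one_div_le_of_defect hGM hK3 h3⟩

end Reduction

/-- Registered helper sub-goal `helper_terminationReduction` (= `terminationLocality_of_oneBlock` in
stub form): the registered two-block resistance form of `stub_terminationLocality` follows from the
`N`-uniform ONE-block division-free estimate plus positivity of the conductances. -/
theorem helper_terminationReduction : ∀ (ω₂ lam β γ T : ℝ) {C : ℝ}, (∀ N M : ℕ, 2 ≤ N → 2 ≤ M → ∀ (g : Fin 4 → PhaseSpace (N + M) → ℝ) (gN : PhaseSpace N → ℝ), (∀ a : Fin 4, g a ∈ deviceForwardFields ω₂ lam β γ T N M (termSite N M a)) → gN ∈ plainForwardFields ω₂ lam β γ T N → kuboMatrix ω₂ lam β γ T N M g 0 0 - plainKubo ω₂ lam β γ T N gN ≤ C * plainKubo ω₂ lam β γ T N gN * kuboMatrix ω₂ lam β γ T N M g 0 0) → ∀ (N M : ℕ), 2 ≤ N → 2 ≤ M → ∀ (g : Fin 4 → PhaseSpace (N + M) → ℝ) (gN : PhaseSpace N → ℝ) (gM : PhaseSpace M → ℝ), (∀ a : Fin 4, g a ∈ deviceForwardFields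 ω₂ lam β γ T N M (termSite N M a)) → gN ∈ plainForwardFields ω₂ lam β γ T N → gM ∈ plainForwardFields ω₂ lam β γ T M → 0 < plainKubo ω₂ lam β γ T N gN → 0 < plainKubo ω₂ lam β γ T M gM → 0 < kuboMatrix ω₂ lam β γ T N M g 0 0 → 0 < kuboMatrix ω₂ lam β γ T N M g 3 3 → 1 / plainKubo ω₂ lam β γ T N gN - 1 / kuboMatrix ω₂ lam β γ T N M g 0 0 ≤ C ∧ 1 / plainKubo ω₂ lam β γ T M gM - 1 / kuboMatrix ω₂ lam β γ T N M g 3 3 ≤ C :=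
  fun ω₂ lam β γ T _ h N M hN hM g gN gM hg hgN hgM hGN hGM hK0 hK3 =>
    terminationLocality_of_oneBlock ω₂ lam β γ T h N M hN hM g gN gM hg hgN hgM hGN hGM hK0 hK3

end Summit.AtomisticToContinuum.FouriersLaw.Theorems.SuperadditiveResistance.TerminationLocality

end
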